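import Summits.BirchSwinnertonDyer.Rank1Residual.X2.GreenbergVatsalTorsionIso
import HarnessLib

/-!
# The Greenberg datum on `A[p]` is intrinsic: an equivariant `θ : N₁ ≃ N₂` carries `N₁⁺_v` onto
# `N₂⁺_v` as soon as inertia MOVES every point of `N_i⁺_v` and acts trivially on `N_i/N_i⁺_v`
# (Greenberg–Vatsal p. 26: "`C[p] = μ_p` and `D[p]` is the maximal quotient of `A[p]` on which
# `I_p` acts trivially")

HONEST FRAMING (cell `b2b-bsdres`, run/shared/lean/b2b/bsd-rank1-residual/, verbatim in every
file): the goal of the cell is to DELETE the COMBINATION-SHAPED residual classes of the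
Birch–Swinnerton-Dyer formula for ALL analytic-rank `≤ 1` elliptic curves over `ℚ` — "full BSD
formula for every rank `≤ 1` curve in class `C`" assembled STRICTLY from published theorems — so
that the rank-`≤ 1` remainder becomes exactly the CONSTRUCTION-SHAPED classes, which are TYPED
(missing-input `Prop`s), NOT attempted. This is not "finishing BSD". Sub-cell
`b2b-bsdres-eisenstein-p2` (CLASS-OWNERS row "X2"), gen 8: research route; NO CLAIM BEYOND STATED
CLASSES; nothing here changes a label. Theorems only (no `def`, no named fact, nothing asserted).

WHAT THIS FILE PROVES. In `X2/GreenbergVatsalTorsionIso.lean` the transfer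
`#(S^{Σ₀}_{M₁}(L) ⊓ H¹[n])·#M₁^H[n] = #(S^{Σ₀}_{M₂}(L) ⊓ H¹[n])·#M₂^H[n]` takes as hypothesis that
the `Γ_K`-isomorphism `θ : M₁[n] ≃ M₂[n]` carries the induced datum `M₁[n] ∩ M₁⁺_v` onto
`M₂[n] ∩ M₂⁺_v` (`hθL`). Greenberg–Vatsal (arXiv:math/9906215 p. 26) observe that for
`A = E[p^∞]`, `p` odd, this is automatic: "the subgroup `C[p]` of `A[p]` is determined by the
action of `I_p`: `C[p] = μ_p` and `D[p]` is the maximal quotient of `A[p]` on which `I_p` acts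
trivially … for an odd prime `p`, the group `S_{A[p]}(ℚ_∞)` is determined just by the isomorphism
class of `A[p]` as a `G_ℚ`-module." The
abstract mechanism, proved here (`map_plus_eq_of_inertia`): if the inertia group `I_v ≤ Γ_K` acts
trivially on `N_i/N_i⁺` (GV's standing hypothesis) and MOVES EVERY POINT of `N_i⁺` — every
`c ∈ N_i⁺` is `τ•c' − c'` for some `τ ∈ I_v`, `c' ∈ N_i⁺` (for `C[p] ≅ μ_p`, `p` odd: take `τ` with
`ω(τ) = 2`, `c' = c`) — then EVERY equivariant isomorphism `θ : N₁ ≃ N₂` satisfies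
`θ(N₁⁺) = N₂⁺`. Consequence `natCard_gvSelmer_inf_torsion_mul_eq_of_inertia`: the transfer of
`…Iso.natCard_gvSelmer_inf_torsion_mul_eq` with `hθL` replaced by these INTRINSIC, per-module
conditions on `M_i[n] ∩ M_i⁺_v` (`v ∣ p`) — so the only coupling between `E₁` and `E₂` left in the
kernel statement is the bare `Γ_K`-isomorphism `E₁[p] ≅ E₂[p]` (route G's `TorsionIso`).

References: Greenberg–Vatsal, Invent. Math. 142 (2000) = arXiv:math/9906215, §2 p. 26.
-/

noncomputable section

open scoped Classical AddSubgroup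

open NumberField IsDedekindDomain Field
open Literature.NumberTheory.EllipticCurves Literature.NumberTheory.EllipticCurves.GreenbergSelmer
  Literature.NumberTheory.GaloisRepresentations
  Summit.BirchSwinnertonDyer.Rank1Residual.X2.TorsionComparison
  Summit.BirchSwinnertonDyer.Rank1Residual.X2.GreenbergVatsalTorsion
  Summit.BirchSwinnertonDyer.Rank1Residual.X2.GreenbergVatsalTorsionIso

universe u

namespace Summit.BirchSwinnertonDyer.Rank1Residual.X2.GreenbergVatsalTorsionLine

variable {K : Type u} [Field K] [NumberField K]

/-! ## §1. Intrinsic data are respected by every equivariant isomorphism -/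

section Intrinsic

variable {N₁ : Type u} [AddCommGroup N₁] [DistribMulAction (absoluteGaloisGroup K) N₁]
variable {N₂ : Type u} [AddCommGroup N₂] [DistribMulAction (absoluteGaloisGroup K) N₂]
variable {v : HeightOneSpectrum (𝓞 K)} (D₁ : LocalDatum K N₁ v) (D₂ : LocalDatum K N₂ v)
  (θ : N₁ ≃+ N₂)

/-- **One inclusion: `θ(N₁⁺) ⊆ N₂⁺`** if `I_v` moves every point of `N₁⁺` (`c = τ•c' − c'`) and acts
trivially on `N₂/N₂⁺` (then `θ c = τ•θc' − θc' ∈ N₂⁺`). [cite: GreenbergVatsal2000, §2 p. 26] -/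
theorem map_plus_le_of_inertia
    (hθ : ∀ (g : absoluteGaloisGroup K) (m : N₁), θ (g • m) = g • θ m)
    (hgen₁ : ∀ c ∈ D₁.plus, ∃ τ ∈ inertia v, ∃ c' ∈ D₁.plus, τ • c' - c' = c)
    (htriv₂ : ∀ τ ∈ inertia v, ∀ x : N₂, τ • x - x ∈ D₂.plus) :
    D₁.plus.map (θ : N₁ →+ N₂) ≤ D₂.plus := by
  rintro _ ⟨c, hc, rfl⟩
  obtain ⟨τ, hτ, c', -, rfl⟩ := hgen₁ c hc
  change θ (τ • c' - c') ∈ D₂.plus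
  rw [map_sub, hθ]
  exact htriv₂ τ hτ (θ c')

/-- **`θ(N₁⁺_v) = N₂⁺_v` for EVERY equivariant isomorphism `θ : N₁ ≃ N₂`**, provided, for
`i = 1, 2`, the inertia group `I_v` moves every point of `N_i⁺_v` and acts trivially on
`N_i/N_i⁺_v` — the mechanism of Greenberg–Vatsal's "`C[p] = μ_p` and `D[p]` is the maximal
quotient of `A[p]` on which `I_p` acts trivially" (`p` odd).
[cite: GreenbergVatsal2000, §2 p. 26] -/
theorem map_plus_eq_of_inertia
    (hθ : ∀ (g : absoluteGaloisGroup K) (m : N₁), θ (g • m) = g • θ m)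
    (hgen₁ : ∀ c ∈ D₁.plus, ∃ τ ∈ inertia v, ∃ c' ∈ D₁.plus, τ • c' - c' = c)
    (hgen₂ : ∀ c ∈ D₂.plus, ∃ τ ∈ inertia v, ∃ c' ∈ D₂.plus, τ • c' - c' = c)
    (htriv₁ : ∀ τ ∈ inertia v, ∀ x : N₁, τ • x - x ∈ D₁.plus)
    (htriv₂ : ∀ τ ∈ inertia v, ∀ x : N₂, τ • x - x ∈ D₂.plus) :
    D₁.plus.map (θ : N₁ →+ N₂) = D₂.plus := by
  refine le_antisymm (map_plus_le_of_inertia D₁ D₂ θ hθ hgen₁ htriv₂) fun c hc ↦ ?_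
  have hθ' : ∀ (g : absoluteGaloisGroup K) (m : N₂), θ.symm (g • m) = g • θ.symm m :=
    symm_equivariant θ hθ
  have hmem : θ.symm c ∈ D₁.plus :=
    map_plus_le_of_inertia D₂ D₁ θ.symm hθ' hgen₂ htriv₁ ⟨c, hc, rfl⟩
  exact ⟨θ.symm c, hmem, θ.apply_symm_apply c⟩

end Intrinsic

/-! ## §2. The induced torsion data inherit both conditions -/

section Torsion

variable {M : Type u} [AddCommGroup M] [DistribMulAction (absoluteGaloisGroup K) M]
  {v : HeightOneSpectrum (𝓞 K)} (N : LocalDatum K M v) (n : ℕ)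

/-- `I_v` acts trivially on `M[n]/(M[n] ∩ M⁺_v)` if it does on `M/M⁺_v`. [folklore] -/
theorem torsionDatum_triv (htriv : ∀ τ ∈ inertia v, ∀ x : M, τ • x - x ∈ N.plus) :
    ∀ τ ∈ inertia v, ∀ x : M[(n : ℤ)], τ • x - x ∈ (torsionDatum N n).plus :=
  fun τ hτ x ↦ by
    change ((τ • x - x : M[(n : ℤ)]) : M) ∈ N.plus
    rw [AddSubgroupClass.coe_sub, AddSubgroup.torsionBy.coe_smul]
    exact htriv τ hτ x

end Torsion

/-! ## §3. The transfer with intrinsic data -/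

section Transfer

variable (H : Subgroup (absoluteGaloisGroup K)) [H.Normal]
variable (M₁ : Type u) [AddCommGroup M₁] [DistribMulAction (absoluteGaloisGroup K) M₁]
  [TopologicalSpace M₁] [DiscreteTopology M₁]
variable (M₂ : Type u) [AddCommGroup M₂] [DistribMulAction (absoluteGaloisGroup K) M₂]
  [TopologicalSpace M₂] [DiscreteTopology M₂]
variable (p : ℕ) (L₁ : Data K M₁ p) (L₂ : Data K M₂ p) (S₀ : Set (HeightOneSpectrum (𝓞 K))) (n : ℕ)

/-- **Greenberg–Vatsal's comparison WITHOUT `H⁰ = 0`, two modules, intrinsic data.** As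
`GreenbergVatsalTorsionIso.natCard_gvSelmer_inf_torsion_mul_eq`, but the compatibility of
`θ : M₁[n] ≃ M₂[n]` with the data is REPLACED by the intrinsic conditions "`I_v` moves every point
of `M_i[n] ∩ M_i⁺_v`" (`hgen_i`; for `E[p]` with `C[p] ≅ μ_p`, `p` odd: `τ` with `ω(τ) = 2`) — the
triviality of `I_v` on the graded pieces being already among the hypotheses (`htriv_i`). So
**`#(S^{Σ₀}_{M₁}(L) ⊓ H¹[n])·#M₁^H[n] = #(S^{Σ₀}_{M₂}(L) ⊓ H¹[n])·#M₂^H[n]` for ANY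
`Γ_K`-isomorphism `θ : M₁[n] ≃ M₂[n]`** ("`E₁[p] ≅ E₂[p]` as `G_ℚ`-modules", route G's
`TorsionIso`).
[cite: GreenbergVatsal2000, §2 Prop. (2.8) and pp. 26–27] -/
theorem natCard_gvSelmer_inf_torsion_mul_eq_of_inertia
    (hM₁ : ∀ m : M₁, Continuous fun g : absoluteGaloisGroup K ↦ g • m)
    (hM₂ : ∀ m : M₂, Continuous fun g : absoluteGaloisGroup K ↦ g • m)
    (hdiv₁ : ∀ m : M₁, ∃ m' : M₁, n • m' = m) (hdiv₂ : ∀ m : M₂, ∃ m' : M₂, n • m' = m)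
    (hunr₁ : ∀ v : HeightOneSpectrum (𝓞 K), v ∉ S₀ → ((p : ℕ) : 𝓞 K) ∉ v.asIdeal →
      ∀ x ∈ inertia v, ∀ m : M₁, x • m = m)
    (hunr₂ : ∀ v : HeightOneSpectrum (𝓞 K), v ∉ S₀ → ((p : ℕ) : 𝓞 K) ∉ v.asIdeal →
      ∀ x ∈ inertia v, ∀ m : M₂, x • m = m)
    (htriv₁ : ∀ (v : HeightOneSpectrum (𝓞 K)) (hv : ((p : ℕ) : 𝓞 K) ∈ v.asIdeal),
      ∀ x ∈ inertia v, ∀ m : M₁, x • m - m ∈ (L₁ v hv).plus)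
    (htriv₂ : ∀ (v : HeightOneSpectrum (𝓞 K)) (hv : ((p : ℕ) : 𝓞 K) ∈ v.asIdeal),
      ∀ x ∈ inertia v, ∀ m : M₂, x • m - m ∈ (L₂ v hv).plus)
    (hgen₁ : ∀ (v : HeightOneSpectrum (𝓞 K)) (hv : ((p : ℕ) : 𝓞 K) ∈ v.asIdeal),
      ∀ c ∈ (torsionData L₁ n v hv).plus, ∃ τ ∈ inertia v,
        ∃ c' ∈ (torsionData L₁ n v hv).plus, τ • c' - c' = c)
    (hgen₂ : ∀ (v : HeightOneSpectrum (𝓞 K)) (hv : ((p : ℕ) : 𝓞 K) ∈ v.asIdeal),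
      ∀ c ∈ (torsionData L₂ n v hv).plus, ∃ τ ∈ inertia v,
        ∃ c' ∈ (torsionData L₂ n v hv).plus, τ • c' - c' = c)
    [Finite (invariants H M₁)] [Finite (invariants H M₂)]
    (θ : M₁[(n : ℤ)] ≃+ M₂[(n : ℤ)])
    (hθ : ∀ (g : absoluteGaloisGroup K) (m : M₁[(n : ℤ)]), θ (g • m) = g • θ m) :
    Nat.card (gvSelmer H M₁ p L₁ S₀ ⊓ (subgroupH1 H M₁)[(n : ℤ)] : AddSubgroup (subgroupH1 H M₁)) *
        Nat.card ((invariants H M₁)[(n : ℤ)]) =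
      Nat.card (gvSelmer H M₂ p L₂ S₀ ⊓ (subgroupH1 H M₂)[(n : ℤ)] :
          AddSubgroup (subgroupH1 H M₂)) * Nat.card ((invariants H M₂)[(n : ℤ)]) :=
  natCard_gvSelmer_inf_torsion_mul_eq H M₁ M₂ p L₁ L₂ S₀ n hM₁ hM₂ hdiv₁ hdiv₂ hunr₁ hunr₂ htriv₁
    htriv₂ θ hθ fun v hv ↦
      map_plus_eq_of_inertia (torsionData L₁ n v hv) (torsionData L₂ n v hv) θ hθ (hgen₁ v hv)
        (hgen₂ v hv) (torsionDatum_triv (L₁ v hv) n (htriv₁ v hv))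
        (torsionDatum_triv (L₂ v hv) n (htriv₂ v hv))

end Transfer

end Summit.BirchSwinnertonDyer.Rank1Residual.X2.GreenbergVatsalTorsionLine

end
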